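import Literature.MathematicalPhysics.QuantumManyBody.BogoliubovQuarticAssembly
import Literature.MathematicalPhysics.QuantumManyBody.BogoliubovWeylTrialFunctional
import Literature.MathematicalPhysics.QuantumManyBody.CubicTrialVectorScalars
import HarnessLib

/-!
# The trial functional of the cubic vector: reduction to scalars

Topic `Literature/MathematicalPhysics/QuantumManyBody`, namespace `BoseGas.Fock`; theorem-only file
for the provefact
`Literature.MathematicalPhysics.QuantumManyBody.BoseGas.BastiCenatiempoSchlein2021_upperBound`
(Props. 3.1–3.2 of [BastiCenatiempoSchlein2021] for the cubic trial vector `ξ_ν`, with all main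
terms kept symbolic and all errors expressed through scalar norm parameters).

* Moments of the cubic vector (`sum_sum_fockInner_pderiv_pderiv_cubicVector_le`):
  `∑_{x,y}‖a_ya_xξ_ν‖² ≤ 9∑_S|c_S|²|S|²` (at most `3|S|` occupied modes in the monomial of `S`),
  to be combined with `∑_S|c_S|²|S|² ≤ ((∑|κ|²)² + ∑|κ|²)‖ξ_ν‖²`
  (`sum_normSq_setCoeff_mul_card_sq_le`) and `∑‖a_pξ_ν‖² = 3∑_S|c_S|²|S| ≤ 3(∑|κ|²)‖ξ_ν‖²`.
* The kinetic term (`kinetic_cubicVector_le`): `∑ε‖A_pξ_ν‖² ≤ (∑εσ² + ∑_τ w̃_τ|κ_τ|²)‖ξ_ν‖²`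
  (`3ℤ`-grading kills `E₂`; `⟨𝒦⟩ + E₁` by the hereditary bound (5.3)).
* The cubic block (`re_cubicBlock_cubicVector_le`): the real part of the triple-form `ℒ⁽³⁾`
  (`BogoliubovCubicBlock.L3_block_eq`) is `Re ∑ cubicCoeff·⟨ξ_ν,a†a†a†ξ_ν⟩`, freed into
  `Re(∑_τ c̃_τ conj κ_τ)‖ξ_ν‖²` minus cutoff defects bounded through the coincidence sups.
* The hard block (`re_hardBlock_cubicVector_le`): `Re 𝒱_N^{(H)}`-pairing = main term (5.13) times
  `‖ξ_ν‖²` up to pair cutoff defects (soft-slot sum sup `A₀`, coincidence sups) and `V₂`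
  (`16W₀g₀⁴∑|c_S|²|S|²`).
* **The assembly** (`trialNumerator_cubicVector_le`): kinetic + `Re(quartic form)/(2L³)` of the
  trial functional of `tsum_trialWeight_mul_periodicGroundStateEnergy_le` for `ξ = ξ_ν` is at most
  `‖ξ_ν‖²·{∑εσ² + ∑_τ w̃|κ|² + (2L³)⁻¹[Re C + Re ∑_{b=b'}κ'κ̄K̃ + √N₀ Re ∑ c̃_τ conj κ_τ] + (2L³)⁻¹·errors}`
  with every error an explicit polynomial in `K₁ = ∑|κ|²` and the sup parameters — Props. 3.1–3.2
  of [ibid.] with the main terms symbolic (their evaluation with the scattering equation is the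
  resummation of §3, done elsewhere) and the errors in closed form.

## References

* [BastiCenatiempoSchlein2021] G. Basti, S. Cenatiempo, B. Schlein, Forum Math. Sigma 9 (2021) e74,
  arXiv:2101.06222: Prop. 2.3, Props. 3.1–3.2, §§4–5.
-/

noncomputable section

namespace Literature.MathematicalPhysics.QuantumManyBody.BoseGas

open Complex MvPolynomial Finset
open scoped ComplexConjugate BigOperators

namespace Fock

variable {ι : Type*} [DecidableEq ι] [LinearOrder ι] {e : ι → Momentum} {PH PS : Finset ι}

/-! ### Moments of the cubic vector -/

section Moments

variable [Fintype ι]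

/-- **`‖a_ya_xξ_ν‖²` for `x ≠ y`**: `∑_{θ(S), x, y occupied} |c_S|²` (unique pairing).
[cite: BastiCenatiempoSchlein2021, §5.1 (the structure behind Prop. 2.3)] -/
theorem fockInner_pderiv_pderiv_cubicVector_self (hHS : Disjoint PH PS) (κ : Triple e PH PS → ℂ)
    {x y : ι} (hxy : x ≠ y) :
    fockInner (pderiv y (pderiv x (cubicVector e PH PS κ))) (pderiv y (pderiv x (cubicVector e PH PS κ))) =
      ∑ S : Finset (Triple e PH PS), (if TripleAdm e S ∧ setOcc Triple.u Triple.a Triple.b S x = 1 ∧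
          setOcc Triple.u Triple.a Triple.b S y = 1 then ((‖setCoeff κ (TripleAdm e) S‖ ^ 2 : ℝ) : ℂ) else 0) := by
  classical
  unfold cubicVector
  rw [fockInner_pderiv_pderiv_setVector (fun S hS => TripleAdm.setOcc_le_one hHS hS) hxy hxy]
  refine Finset.sum_congr rfl fun S _ => ?_
  rw [Finset.sum_eq_single_of_mem S (Finset.mem_univ S)]
  · by_cases h : TripleAdm e S ∧ setOcc Triple.u Triple.a Triple.b S x = 1 ∧ setOcc Triple.u Triple.a Triple.b S y = 1
    · rw [if_pos ⟨h.1, h.1, h.2.1, h.2.2, h.2.1, h.2.2, rfl⟩, if_pos h, ← Complex.normSq_eq_conj_mul_self,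
        Complex.normSq_eq_norm_sq]
    · rw [if_neg h, if_neg]
      rintro ⟨h1, -, h3, h4, -, -, -⟩
      exact h ⟨h1, h3, h4⟩
  · intro S' _ hS'
    rw [if_neg]
    rintro ⟨hS, hS'a, -, -, -, -, hocc⟩
    exact hS' (TripleAdm.eq_of_setOcc_eq hHS hS'a hS (add_right_cancel hocc).symm)

omit [DecidableEq ι] in
/-- The number of occupied modes of `S` is at most `3|S|`. [folklore] -/
theorem sum_ite_setOcc_ne_zero_le (S : Finset (Triple e PH PS)) :
    ∑ x, (if setOcc Triple.u Triple.a Triple.b S x ≠ 0 then (1 : ℝ) else 0) ≤ 3 * S.card := by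
  have h : ∀ x, (if setOcc Triple.u Triple.a Triple.b S x ≠ 0 then (1 : ℝ) else 0) ≤
      (setOcc Triple.u Triple.a Triple.b S x : ℝ) := by
    intro x
    split_ifs with hx
    · exact_mod_cast Nat.one_le_iff_ne_zero.2 hx
    · positivity
  refine (Finset.sum_le_sum fun x _ => h x).trans (le_of_eq ?_)
  have hdeg := degree_setOcc (u := Triple.u) (a := Triple.a) (b := Triple.b) S
  rw [Finsupp.degree_eq_sum] at hdeg
  exact_mod_cast hdeg

/-- **Second moment of the cubic vector**: `∑_{x,y}‖a_ya_xξ_ν‖² ≤ 9 ∑_S |c_S|²|S|²`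
(`⟨ξ_ν, 𝒩(𝒩-1)ξ_ν⟩`; at most `3|S|` occupied modes). [cite: BastiCenatiempoSchlein2021, Prop. 2.3 (`j = 2`)] -/
theorem sum_sum_fockInner_pderiv_pderiv_cubicVector_le (hHS : Disjoint PH PS) (κ : Triple e PH PS → ℂ) :
    ∑ x, ∑ y, (fockInner (pderiv y (pderiv x (cubicVector e PH PS κ))) (pderiv y (pderiv x (cubicVector e PH PS κ)))).re ≤
      9 * ∑ S : Finset (Triple e PH PS), ‖setCoeff κ (TripleAdm e) S‖ ^ 2 * (S.card : ℝ) ^ 2 := by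
  classical
  set occ := setOcc (Triple.u (e := e) (PH := PH) (PS := PS)) Triple.a Triple.b with hocc
  -- pointwise bound by the occupation indicators
  have hpt : ∀ x y, (fockInner (pderiv y (pderiv x (cubicVector e PH PS κ))) (pderiv y (pderiv x (cubicVector e PH PS κ)))).re ≤
      ∑ S : Finset (Triple e PH PS), (if occ S x ≠ 0 then (1 : ℝ) else 0) * (if occ S y ≠ 0 then (1 : ℝ) else 0) *
        ‖setCoeff κ (TripleAdm e) S‖ ^ 2 := by
    intro x y
    by_cases hxy : x = y
    · subst hxy
      rw [pderiv_pderiv_self_cubicVector hHS, fockInner_zero_left, Complex.zero_re]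
      exact Finset.sum_nonneg fun S _ => by positivity
    · rw [fockInner_pderiv_pderiv_cubicVector_self hHS κ hxy, Complex.re_sum]
      refine Finset.sum_le_sum fun S _ => ?_
      by_cases hC : TripleAdm e S ∧ setOcc Triple.u Triple.a Triple.b S x = 1 ∧ setOcc Triple.u Triple.a Triple.b S y = 1
      · have hx : occ S x ≠ 0 := by show setOcc Triple.u Triple.a Triple.b S x ≠ 0; rw [hC.2.1]; exact one_ne_zero
        have hy : occ S y ≠ 0 := by show setOcc Triple.u Triple.a Triple.b S y ≠ 0; rw [hC.2.2]; exact one_ne_zero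
        rw [if_pos hC, if_pos hx, if_pos hy, Complex.ofReal_re, one_mul, one_mul]
      · rw [if_neg hC, Complex.zero_re]
        positivity
  calc ∑ x, ∑ y, (fockInner (pderiv y (pderiv x (cubicVector e PH PS κ))) (pderiv y (pderiv x (cubicVector e PH PS κ)))).re
      ≤ ∑ x, ∑ y, ∑ S : Finset (Triple e PH PS), (if occ S x ≠ 0 then (1 : ℝ) else 0) *
          (if occ S y ≠ 0 then (1 : ℝ) else 0) * ‖setCoeff κ (TripleAdm e) S‖ ^ 2 :=
        Finset.sum_le_sum fun x _ => Finset.sum_le_sum fun y _ => hpt x y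
    _ = ∑ S : Finset (Triple e PH PS), ‖setCoeff κ (TripleAdm e) S‖ ^ 2 *
          ((∑ x, (if occ S x ≠ 0 then (1 : ℝ) else 0)) * ∑ y, (if occ S y ≠ 0 then (1 : ℝ) else 0)) := by
        rw [Finset.sum_comm]
        simp only [Finset.sum_comm (s := (Finset.univ : Finset ι)) (t := (Finset.univ : Finset (Finset (Triple e PH PS))))]
        refine Finset.sum_congr rfl fun S _ => ?_
        rw [Finset.sum_mul_sum, Finset.mul_sum]
        refine Finset.sum_congr rfl fun x _ => ?_
        rw [Finset.mul_sum]
        refine Finset.sum_congr rfl fun y _ => ?_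
        ring
    _ ≤ ∑ S : Finset (Triple e PH PS), ‖setCoeff κ (TripleAdm e) S‖ ^ 2 * ((3 * S.card) * (3 * S.card)) := by
        refine Finset.sum_le_sum fun S _ => mul_le_mul_of_nonneg_left ?_ (sq_nonneg _)
        have h1 := sum_ite_setOcc_ne_zero_le (e := e) S
        have h0 : 0 ≤ ∑ x, (if occ S x ≠ 0 then (1 : ℝ) else 0) := Finset.sum_nonneg fun x _ => by positivity
        exact mul_le_mul h1 h1 h0 (by positivity)
    _ = 9 * ∑ S : Finset (Triple e PH PS), ‖setCoeff κ (TripleAdm e) S‖ ^ 2 * (S.card : ℝ) ^ 2 := by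
        rw [Finset.mul_sum]
        refine Finset.sum_congr rfl fun S _ => ?_
        ring

end Moments

/-! ### The kinetic term of the trial functional for the cubic vector -/

section Kinetic

variable [Fintype ι] {z : ι} {σ : ι → ι} {P : Finset ι} {N₀ : ℝ} {t : ι → ℝ}

/-- The cubic vector is a superposition of `3m`-particle states: constant weight `1 ∈ ℤ/3ℤ`.
[cite: BastiCenatiempoSchlein2021, §4 ("`ξ_ν` is a superposition of states with `3m` particles")] -/
theorem isWeightedHomogeneous_cubicVector_zmod3 (κ : Triple e PH PS → ℂ) :
    IsWeightedHomogeneous (fun _ : ι => (1 : ZMod 3)) (cubicVector e PH PS κ) 0 :=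
  isWeightedHomogeneous_cubicVector κ _ fun _ => by decide

/-- The cubic vector is balanced between `P_H` and `P_S` (weights `1`, `-2`).
[cite: BastiCenatiempoSchlein2021, §4 ("the operator preserves the number of particles in `P_S` and `P_H`")] -/
theorem isWeightedHomogeneous_cubicVector_hs (hHS : Disjoint PH PS) (κ : Triple e PH PS → ℂ) :
    IsWeightedHomogeneous (fun i : ι => if i ∈ PH then (1 : ℤ) else if i ∈ PS then -2 else 0)
      (cubicVector e PH PS κ) 0 :=
  isWeightedHomogeneous_cubicVector κ _ (hsWeight_triple hHS)

/-- `a_pξ_ν = 0` off `P_H ∪ P_S`. [cite: BastiCenatiempoSchlein2021, §4] -/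
theorem pderiv_cubicVector_eq_zero_of_not_mem_union (κ : Triple e PH PS → ℂ) {p : ι} (hp : p ∉ PH ∪ PS) :
    pderiv p (cubicVector e PH PS κ) = 0 :=
  pderiv_cubicVector_eq_zero κ (fun h => hp (Finset.mem_union_left _ h)) (fun h => hp (Finset.mem_union_right _ h))

/-- **The kinetic term of the trial functional for the cubic vector**:
`∑_p ε_p ‖A_pξ_ν‖² ≤ (∑_p ε_pσ_p²)‖ξ_ν‖² + (∑_τ w̃_τ|κ_τ|²)‖ξ_ν‖²`, `w = ε(γ²+σ²)`,
`w̃_τ = w_u + w_a + w_b`, for an even weight `ε ≥ 0` vanishing at the condensate mode — the terms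
`∑p²σ_p²`, `⟨𝒦⟩ ≤ (eq:K)` and `E₁` of [ibid.] (`E₂ = 0` by the `3ℤ`-grading).
[cite: BastiCenatiempoSchlein2021, §4 (`T*𝒦T`, `E₁`, `E₂`), §5.1 (5.2)–(5.3)] -/
theorem kinetic_cubicVector_le (hσ : Function.Involutive σ) (hP : ∀ p ∈ P, σ p ∉ P) (hHS : Disjoint PH PS)
    (κ : Triple e PH PS → ℂ) (ε : ι → ℝ) (hε : ∀ p, 0 ≤ ε p) (hεσ : ∀ p, ε (σ p) = ε p) (hεz : ε z = 0) :
    ∑ p, ε p * (fockInner (conjAn z σ P N₀ t p (cubicVector e PH PS κ)) (conjAn z σ P N₀ t p (cubicVector e PH PS κ))).re ≤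
      ((∑ p, ε p * bogSigma σ P t p ^ 2) +
        ∑ τ : Triple e PH PS, (ε τ.u * (bogGamma σ P t τ.u ^ 2 + bogSigma σ P t τ.u ^ 2) +
          ε τ.a * (bogGamma σ P t τ.a ^ 2 + bogSigma σ P t τ.a ^ 2) +
          ε τ.b * (bogGamma σ P t τ.b ^ 2 + bogSigma σ P t τ.b ^ 2)) * ‖κ τ‖ ^ 2) *
        (fockInner (cubicVector e PH PS κ) (cubicVector e PH PS κ)).re := by
  rw [sum_mul_fockInner_conjAn_self_re ε hεz,
    sum_mul_fockInner_bogAn_self_re_of_graded hσ hP ε hεσ (isWeightedHomogeneous_cubicVector_zmod3 κ)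
      (fun p h => absurd h (by decide)), add_mul]
  refine add_le_add le_rfl ?_
  have h := sum_mul_fockInner_pderiv_cubicVector_le hHS κ
    (fun p => ε p * (bogGamma σ P t p ^ 2 + bogSigma σ P t p ^ 2)) (fun p => mul_nonneg (hε p) (by positivity))
  simpa only [mul_assoc] using h

end Kinetic

/-! ### The cubic and the hard quartic block of the cubic vector -/

section Blocks

variable [Fintype ι] {σ : ι → ι} {P : Finset ι} {t : ι → ℝ}

omit [DecidableEq ι] [LinearOrder ι] [Fintype ι] in
/-- `⟨X_iX_jX_kξ, ξ⟩ = conj ⟨ξ, X_iX_jX_kξ⟩`. [folklore] -/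
theorem fockInner_create_self_eq_conj (i j k : ι) (ξ : MvPolynomial ι ℂ) :
    fockInner (X i * (X j * (X k * ξ))) ξ = conj (fockInner ξ (X i * (X j * (X k * ξ)))) :=
  (conj_fockInner _ _).symm

/-- **The cubic block of the cubic vector, freed and bounded.** With `T = ⟨ξ_ν, a†_ia†_ja†_kξ_ν⟩`,
the real part of the triple-form cubic block `∑_{mom}(F·T + G·T̄)` equals
`Re ∑ cubicCoeff·T = Re[(∑_τ c̃_τ conj κ_τ)]‖ξ_ν‖² - Re ∑_τ c̃_τ conj κ_τ D_τ` and the defect part is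
at most `F_m(F₁K₁ + F₂K₁²)‖ξ_ν‖²` (`|c̃_τ| ≤ F_m`, coincidence sups `F₁, F₂` of `|κ|`) — the main term
`⟨ξ_ν, 𝒞_Nξ_ν⟩ = I + J` of [ibid., (5.8)–(5.11)] together with the crude treatment of `F₁`–`F₃`.
[cite: BastiCenatiempoSchlein2021, §4 (`𝒞_N`, `F₁`–`F₃`), §5.2 (5.8)–(5.17)] -/
theorem re_cubicBlock_cubicVector_le (he : Function.Injective e) (hHS : Disjoint PH PS)
    (κ : Triple e PH PS → ℂ) (W : Momentum → ℂ) {Fm F₁ F₂ : ℝ} (hFm : 0 ≤ Fm) (hF₁ : 0 ≤ F₁) (hF₂ : 0 ≤ F₂)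
    (hFmle : ∀ τ : Triple e PH PS, ‖arrSum (cubicCoeff e W (bogGamma σ P t) (bogSigma σ P t)) τ‖ ≤ Fm)
    (hF₁le : ∀ τ' : Triple e PH PS, ∑ τ : Triple e PH PS,
      (if τ.b = τ'.b ∨ (∃ p, (p = τ.u ∨ p = τ.a) ∧ (p = τ'.u ∨ p = τ'.a)) ∨
          (∃ p, (p = τ.u ∨ p = τ.a) ∧ e p + e p + e τ'.b = 0) ∨ (∃ p', (p' = τ'.u ∨ p' = τ'.a) ∧ e p' + e p' + e τ.b = 0)
        then ‖κ τ‖ else 0) ≤ F₁)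
    (hF₂le : ∀ τj τk : Triple e PH PS, τj ≠ τk → ∑ τ : Triple e PH PS,
      (if (∃ pj pk, (pj = τj.u ∨ pj = τj.a) ∧ (pk = τk.u ∨ pk = τk.a) ∧ e pj + e pk + e τ.b = 0) ∨
          (∃ p pk, (p = τ.u ∨ p = τ.a) ∧ (pk = τk.u ∨ pk = τk.a) ∧ e p + e pk + e τj.b = 0)
        then ‖κ τ‖ else 0) ≤ F₂) :
    (∑ i, ∑ j, ∑ k, (if e i + e j + e k = 0 then
        ((W (-e k) + W (e j)) * ((bogGamma σ P t i * bogSigma σ P t j * bogSigma σ P t k : ℝ) : ℂ) +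
            (W (-e i) + W (e j)) * ((bogGamma σ P t i * bogGamma σ P t j * bogSigma σ P t k : ℝ) : ℂ)) *
          fockInner (cubicVector e PH PS κ) (X i * (X j * (X k * cubicVector e PH PS κ))) +
        ((W (e k) + W (-e j)) * ((bogGamma σ P t i * bogSigma σ P t j * bogSigma σ P t k : ℝ) : ℂ) +
            (W (e i) + W (-e j)) * ((bogGamma σ P t i * bogGamma σ P t j * bogSigma σ P t k : ℝ) : ℂ)) *
          fockInner (X i * (X j * (X k * cubicVector e PH PS κ))) (cubicVector e PH PS κ) else 0)).re ≤
      (∑ τ : Triple e PH PS, arrSum (cubicCoeff e W (bogGamma σ P t) (bogSigma σ P t)) τ * conj (κ τ)).re * cubicNormSq κ +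
        Fm * (F₁ * ampNormSq κ + F₂ * ampNormSq κ ^ 2) * cubicNormSq κ := by
  set ξ := cubicVector e PH PS κ with hξ
  set cc := cubicCoeff e W (bogGamma σ P t) (bogSigma σ P t) with hcc
  -- pointwise: the real part only sees `cubicCoeff · T`
  have hpt : ∀ i j k, (if e i + e j + e k = 0 then
      ((W (-e k) + W (e j)) * ((bogGamma σ P t i * bogSigma σ P t j * bogSigma σ P t k : ℝ) : ℂ) +
          (W (-e i) + W (e j)) * ((bogGamma σ P t i * bogGamma σ P t j * bogSigma σ P t k : ℝ) : ℂ)) *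
        fockInner ξ (X i * (X j * (X k * ξ))) +
      ((W (e k) + W (-e j)) * ((bogGamma σ P t i * bogSigma σ P t j * bogSigma σ P t k : ℝ) : ℂ) +
          (W (e i) + W (-e j)) * ((bogGamma σ P t i * bogGamma σ P t j * bogSigma σ P t k : ℝ) : ℂ)) *
        fockInner (X i * (X j * (X k * ξ))) ξ else 0).re = (cc i j k * fockInner ξ (X i * (X j * (X k * ξ)))).re := by
    intro i j k
    simp only [hcc, cubicCoeff]
    by_cases hm : e i + e j + e k = 0
    · rw [if_pos hm, if_pos hm, fockInner_create_self_eq_conj]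
      simp only [Complex.add_re, Complex.mul_re, Complex.conj_re, Complex.conj_im, add_mul, Complex.add_im,
        Complex.mul_im]
      ring
    · rw [if_neg hm, if_neg hm, zero_mul]
  have hL : (∑ i, ∑ j, ∑ k, (if e i + e j + e k = 0 then
      ((W (-e k) + W (e j)) * ((bogGamma σ P t i * bogSigma σ P t j * bogSigma σ P t k : ℝ) : ℂ) +
          (W (-e i) + W (e j)) * ((bogGamma σ P t i * bogGamma σ P t j * bogSigma σ P t k : ℝ) : ℂ)) *
        fockInner ξ (X i * (X j * (X k * ξ))) +
      ((W (e k) + W (-e j)) * ((bogGamma σ P t i * bogSigma σ P t j * bogSigma σ P t k : ℝ) : ℂ) +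
          (W (e i) + W (-e j)) * ((bogGamma σ P t i * bogGamma σ P t j * bogSigma σ P t k : ℝ) : ℂ)) *
        fockInner (X i * (X j * (X k * ξ))) ξ else 0)).re =
      (∑ i, ∑ j, ∑ k, cc i j k * fockInner ξ (X i * (X j * (X k * ξ)))).re := by
    simp only [Complex.re_sum, hpt]
  rw [hL, sum_mul_cubicExp_eq_freed' hHS κ cc, Complex.sub_re, Complex.re_mul_ofReal]
  -- the defect part
  have hdef : ‖∑ τ : Triple e PH PS, arrSum cc τ * conj (κ τ) * ((cutoffDefect κ τ : ℝ) : ℂ)‖ ≤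
      Fm * (F₁ * ampNormSq κ + F₂ * ampNormSq κ ^ 2) * cubicNormSq κ := by
    calc ‖∑ τ : Triple e PH PS, arrSum cc τ * conj (κ τ) * ((cutoffDefect κ τ : ℝ) : ℂ)‖
        ≤ ∑ τ : Triple e PH PS, (‖arrSum cc τ‖ * ‖κ τ‖) * cutoffDefect κ τ := by
          refine norm_sum_le_of_le _ fun τ _ => ?_
          rw [norm_mul, norm_mul, Complex.norm_conj, Complex.norm_real, Real.norm_of_nonneg (cutoffDefect_nonneg_le κ τ).1]
      _ ≤ _ := sum_mul_cutoffDefect_le he κ (fun τ => ‖arrSum cc τ‖ * ‖κ τ‖) hFm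
          (fun τ => mul_le_mul_of_nonneg_right (hFmle τ) (norm_nonneg _)) hF₁ hF₂ hF₁le hF₂le
  have habs := Complex.abs_re_le_norm (∑ τ : Triple e PH PS, arrSum cc τ * conj (κ τ) * ((cutoffDefect κ τ : ℝ) : ℂ))
  rw [abs_le] at habs
  linarith [habs.1]

/-- **The hard pair-annihilation block of the cubic vector, bounded.** For `|W| ≤ W₀`, `|γ| ≤ g₀` on
`P_H`, the soft-slot sums `∑_{τ': b'=b}|κ_{τ'}| ≤ A₀` and coincidence sups `F₁, F₂` of `|κ|`:
`Re ∑_{P_H⁴} cγγγγ⟨a_qa_pξ_ν, a_{q'}a_{p'}ξ_ν⟩ ≤ Re(∑_{b=b'} κ_{τ'}conj(κ_τ)K̃)‖ξ_ν‖²`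
`+ [8W₀g₀⁴A₀(F₁K₁+F₂K₁²) + 16W₀g₀⁴(K₁²+K₁)]‖ξ_ν‖²` — the main term (5.13) of `⟨ξ_ν,𝒱_N^{(H)}ξ_ν⟩`
with the errors (5.14) (pair cutoff defects) and `V₂` (two triples differ).
[cite: BastiCenatiempoSchlein2021, §5.3 (5.12)–(5.14), Prop. 3.2] -/
theorem re_hardBlock_cubicVector_le (he : Function.Injective e) (hHS : Disjoint PH PS)
    (κ : Triple e PH PS → ℂ) (W : Momentum → ℂ) {W₀ : ℝ} (hW : ∀ k, ‖W k‖ ≤ W₀)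
    {g₀ A₀ F₁ F₂ : ℝ} (hg₀ : 0 ≤ g₀) (hA₀ : 0 ≤ A₀) (hF₁ : 0 ≤ F₁) (hF₂ : 0 ≤ F₂)
    (hgH : ∀ p ∈ PH, |bogGamma σ P t p| ≤ g₀)
    (hA₀le : ∀ τ : Triple e PH PS, ∑ τ' : Triple e PH PS, (if τ'.b = τ.b then ‖κ τ'‖ else 0) ≤ A₀)
    (hF₁le : ∀ τ' : Triple e PH PS, ∑ τ : Triple e PH PS,
      (if τ.b = τ'.b ∨ (∃ p, (p = τ.u ∨ p = τ.a) ∧ (p = τ'.u ∨ p = τ'.a)) ∨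
          (∃ p, (p = τ.u ∨ p = τ.a) ∧ e p + e p + e τ'.b = 0) ∨ (∃ p', (p' = τ'.u ∨ p' = τ'.a) ∧ e p' + e p' + e τ.b = 0)
        then ‖κ τ‖ else 0) ≤ F₁)
    (hF₂le : ∀ τj τk : Triple e PH PS, τj ≠ τk → ∑ τ : Triple e PH PS,
      (if (∃ pj pk, (pj = τj.u ∨ pj = τj.a) ∧ (pk = τk.u ∨ pk = τk.a) ∧ e pj + e pk + e τ.b = 0) ∨
          (∃ p pk, (p = τ.u ∨ p = τ.a) ∧ (pk = τk.u ∨ pk = τk.a) ∧ e p + e pk + e τj.b = 0)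
        then ‖κ τ‖ else 0) ≤ F₂) :
    (∑ p ∈ PH, ∑ q ∈ PH, ∑ p' ∈ PH, ∑ q' ∈ PH, pairCoeff' e W p q p' q' *
        ((bogGamma σ P t q * bogGamma σ P t p * (bogGamma σ P t q' * bogGamma σ P t p') : ℝ) : ℂ) *
          fockInner (pderiv q (pderiv p (cubicVector e PH PS κ))) (pderiv q' (pderiv p' (cubicVector e PH PS κ)))).re ≤
      (∑ τ' : Triple e PH PS, ∑ τ : Triple e PH PS, (if τ.b = τ'.b then
          κ τ' * conj (κ τ) * (hardKernel e W (bogGamma σ P t) PH τ.u τ.a τ'.u τ'.a +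
            hardKernel e W (bogGamma σ P t) PH τ.u τ.a τ'.a τ'.u + hardKernel e W (bogGamma σ P t) PH τ.a τ.u τ'.u τ'.a +
            hardKernel e W (bogGamma σ P t) PH τ.a τ.u τ'.a τ'.u) else 0)).re * cubicNormSq κ +
        (8 * (W₀ * g₀ ^ 4) * A₀ * (F₁ * ampNormSq κ + F₂ * ampNormSq κ ^ 2) +
          16 * (W₀ * g₀ ^ 4) * (ampNormSq κ ^ 2 + ampNormSq κ)) * cubicNormSq κ := by
  have hW₀ : 0 ≤ W₀ := le_trans (norm_nonneg _) (hW 0)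
  set gm := bogGamma σ P t with hgm
  set Kt : Triple e PH PS → Triple e PH PS → ℂ := fun τ' τ => hardKernel e W gm PH τ.u τ.a τ'.u τ'.a +
    hardKernel e W gm PH τ.u τ.a τ'.a τ'.u + hardKernel e W gm PH τ.a τ.u τ'.u τ'.a + hardKernel e W gm PH τ.a τ.u τ'.a τ'.u
    with hKt
  have hKt_le : ∀ τ' τ, ‖Kt τ' τ‖ ≤ 4 * (W₀ * g₀ ^ 4) := by
    intro τ' τ
    have h := norm_hardKernel_le (e := e) (PH := PH) W hW gm hg₀ hgH
    have h1 := h τ.u τ.a τ'.u τ'.a; have h2 := h τ.u τ.a τ'.a τ'.u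
    have h3 := h τ.a τ.u τ'.u τ'.a; have h4 := h τ.a τ.u τ'.a τ'.u
    have := norm_add_le (hardKernel e W gm PH τ.u τ.a τ'.u τ'.a + hardKernel e W gm PH τ.u τ.a τ'.a τ'.u +
      hardKernel e W gm PH τ.a τ.u τ'.u τ'.a) (hardKernel e W gm PH τ.a τ.u τ'.a τ'.u)
    have := norm_add_le (hardKernel e W gm PH τ.u τ.a τ'.u τ'.a + hardKernel e W gm PH τ.u τ.a τ'.a τ'.u)
      (hardKernel e W gm PH τ.a τ.u τ'.u τ'.a)
    have := norm_add_le (hardKernel e W gm PH τ.u τ.a τ'.u τ'.a) (hardKernel e W gm PH τ.u τ.a τ'.a τ'.u)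
    simp only [hKt]
    linarith
  obtain ⟨B, hB, hdec⟩ := quartic_pairing_decomposition' he hHS κ W hW gm hg₀ hgH
  rw [hdec, Complex.add_re]
  have hKt_fold : ∀ τ' τ, hardKernel e W gm PH τ.u τ.a τ'.u τ'.a + hardKernel e W gm PH τ.u τ.a τ'.a τ'.u +
      hardKernel e W gm PH τ.a τ.u τ'.u τ'.a + hardKernel e W gm PH τ.a τ.u τ'.a τ'.u = Kt τ' τ := fun _ _ => rfl
  simp only [hKt_fold]
  -- split main and pair-defect parts
  have hsplit : (∑ τ' : Triple e PH PS, ∑ τ : Triple e PH PS, (if τ.b = τ'.b then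
      κ τ' * conj (κ τ) * Kt τ' τ * (((cubicNormSq κ : ℝ) : ℂ) - ((pairCutoffDefect κ τ' τ : ℝ) : ℂ)) else 0)) =
      (∑ τ' : Triple e PH PS, ∑ τ : Triple e PH PS, (if τ.b = τ'.b then κ τ' * conj (κ τ) * Kt τ' τ else 0)) *
          ((cubicNormSq κ : ℝ) : ℂ) -
        ∑ τ' : Triple e PH PS, ∑ τ : Triple e PH PS, (if τ.b = τ'.b then
          κ τ' * conj (κ τ) * Kt τ' τ * ((pairCutoffDefect κ τ' τ : ℝ) : ℂ) else 0) := by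
    rw [Finset.sum_mul, ← Finset.sum_sub_distrib]
    refine Finset.sum_congr rfl fun τ' _ => ?_
    rw [Finset.sum_mul, ← Finset.sum_sub_distrib]
    refine Finset.sum_congr rfl fun τ _ => ?_
    split_ifs <;> ring
  rw [hsplit, Complex.sub_re, Complex.re_mul_ofReal]
  -- the pair-defect part
  have hD0 : ∀ τ, 0 ≤ cutoffDefect κ τ := fun τ => (cutoffDefect_nonneg_le κ τ).1
  have hpd : ‖∑ τ' : Triple e PH PS, ∑ τ : Triple e PH PS, (if τ.b = τ'.b then
      κ τ' * conj (κ τ) * Kt τ' τ * ((pairCutoffDefect κ τ' τ : ℝ) : ℂ) else 0)‖ ≤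
      8 * (W₀ * g₀ ^ 4) * A₀ * (F₁ * ampNormSq κ + F₂ * ampNormSq κ ^ 2) * cubicNormSq κ := by
    calc ‖∑ τ' : Triple e PH PS, ∑ τ : Triple e PH PS, (if τ.b = τ'.b then
          κ τ' * conj (κ τ) * Kt τ' τ * ((pairCutoffDefect κ τ' τ : ℝ) : ℂ) else 0)‖
        ≤ ∑ τ' : Triple e PH PS, ∑ τ : Triple e PH PS, (if τ.b = τ'.b then
            ‖κ τ'‖ * ‖κ τ‖ * (4 * (W₀ * g₀ ^ 4)) * (cutoffDefect κ τ' + cutoffDefect κ τ) else 0) := by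
          refine norm_sum_le_of_le _ fun τ' _ => norm_sum_le_of_le _ fun τ _ => ?_
          split_ifs with hb
          · rw [norm_mul, norm_mul, norm_mul, Complex.norm_conj, Complex.norm_real,
              Real.norm_of_nonneg (pairCutoffDefect_nonneg_le κ τ' τ).1]
            exact mul_le_mul (mul_le_mul_of_nonneg_left (hKt_le τ' τ) (by positivity))
              (pairCutoffDefect_nonneg_le κ τ' τ).2 (pairCutoffDefect_nonneg_le κ τ' τ).1 (by positivity)
          · rw [norm_zero]
      _ = 4 * (W₀ * g₀ ^ 4) * ((∑ τ' : Triple e PH PS, ‖κ τ'‖ * cutoffDefect κ τ' *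
            ∑ τ : Triple e PH PS, (if τ.b = τ'.b then ‖κ τ‖ else 0)) +
          ∑ τ : Triple e PH PS, ‖κ τ‖ * cutoffDefect κ τ *
            ∑ τ' : Triple e PH PS, (if τ'.b = τ.b then ‖κ τ'‖ else 0)) := by
          rw [mul_add]
          have h1 : ∑ τ' : Triple e PH PS, ∑ τ : Triple e PH PS, (if τ.b = τ'.b then
              ‖κ τ'‖ * ‖κ τ‖ * (4 * (W₀ * g₀ ^ 4)) * (cutoffDefect κ τ' + cutoffDefect κ τ) else 0) =
              ∑ τ' : Triple e PH PS, ∑ τ : Triple e PH PS, (if τ.b = τ'.b then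
                ‖κ τ'‖ * ‖κ τ‖ * (4 * (W₀ * g₀ ^ 4)) * cutoffDefect κ τ' else 0) +
              ∑ τ' : Triple e PH PS, ∑ τ : Triple e PH PS, (if τ.b = τ'.b then
                ‖κ τ'‖ * ‖κ τ‖ * (4 * (W₀ * g₀ ^ 4)) * cutoffDefect κ τ else 0) := by
            rw [← Finset.sum_add_distrib]
            refine Finset.sum_congr rfl fun τ' _ => ?_
            rw [← Finset.sum_add_distrib]
            refine Finset.sum_congr rfl fun τ _ => ?_
            split_ifs <;> ring
          rw [h1]
          congr 1
          · rw [Finset.mul_sum]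
            refine Finset.sum_congr rfl fun τ' _ => ?_
            rw [Finset.mul_sum, Finset.mul_sum]
            refine Finset.sum_congr rfl fun τ _ => ?_
            split_ifs <;> ring
          · rw [Finset.sum_comm, Finset.mul_sum]
            refine Finset.sum_congr rfl fun τ _ => ?_
            rw [Finset.mul_sum, Finset.mul_sum]
            refine Finset.sum_congr rfl fun τ' _ => ?_
            simp only [eq_comm]
            split_ifs <;> ring
      _ ≤ 4 * (W₀ * g₀ ^ 4) * ((∑ τ' : Triple e PH PS, ‖κ τ'‖ * cutoffDefect κ τ' * A₀) +
          ∑ τ : Triple e PH PS, ‖κ τ‖ * cutoffDefect κ τ * A₀) := by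
          refine mul_le_mul_of_nonneg_left (add_le_add ?_ ?_) (by positivity)
          · exact Finset.sum_le_sum fun τ' _ => mul_le_mul_of_nonneg_left (hA₀le τ') (mul_nonneg (norm_nonneg _) (hD0 _))
          · exact Finset.sum_le_sum fun τ _ => mul_le_mul_of_nonneg_left (hA₀le τ) (mul_nonneg (norm_nonneg _) (hD0 _))
      _ = 8 * (W₀ * g₀ ^ 4) * A₀ * ∑ τ : Triple e PH PS, ‖κ τ‖ * cutoffDefect κ τ := by
          simp only [← Finset.sum_mul]; ring
      _ ≤ 8 * (W₀ * g₀ ^ 4) * A₀ * (1 * (F₁ * ampNormSq κ + F₂ * ampNormSq κ ^ 2) * cubicNormSq κ) :=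
          mul_le_mul_of_nonneg_left (sum_mul_cutoffDefect_le he κ (fun τ => ‖κ τ‖) zero_le_one
            (fun τ => by rw [one_mul]) hF₁ hF₂ hF₁le hF₂le) (by positivity)
      _ = _ := by ring
  -- the `B` part
  have hBle : B.re ≤ 16 * (W₀ * g₀ ^ 4) * (ampNormSq κ ^ 2 + ampNormSq κ) * cubicNormSq κ := by
    refine (Complex.re_le_norm B).trans (hB.trans ?_)
    rw [mul_assoc (16 * (W₀ * g₀ ^ 4))]
    exact mul_le_mul_of_nonneg_left (sum_normSq_setCoeff_mul_card_sq_le' κ) (by positivity)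
  have habs := Complex.abs_re_le_norm (∑ τ' : Triple e PH PS, ∑ τ : Triple e PH PS, (if τ.b = τ'.b then
      κ τ' * conj (κ τ) * Kt τ' τ * ((pairCutoffDefect κ τ' τ : ℝ) : ℂ) else 0))
  rw [abs_le] at habs
  nlinarith [habs.1, hpd, hBle]

end Blocks

/-! ### The trial functional of the cubic vector: everything reduced to scalars -/

section Final

variable [Fintype ι] {z : ι} {σ : ι → ι} {P : Finset ι} {N₀ : ℝ} {t : ι → ℝ}

omit [DecidableEq ι] [LinearOrder ι] [Fintype ι] in
/-- `Re a ≤ Re b + ‖a - b‖`. [folklore] -/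
theorem re_le_re_add_norm_sub (a b : ℂ) : a.re ≤ b.re + ‖a - b‖ := by
  have h := Complex.re_le_norm (a - b)
  rw [Complex.sub_re] at h
  linarith

omit [DecidableEq ι] [LinearOrder ι] [Fintype ι] in
/-- Bookkeeping: inserting the moment bounds `M₁ ≤ 3K₁N`, `M₂ ≤ 9(K₁²+K₁)N` into the error of
`norm_quarticForm_sub_main_le`. [folklore] -/
theorem errQ_le_of_moments {N₀ W₀ g₀ s₀ gs₀ Λ S2 S2Q cPS M₁ M₂ K₁ N : ℝ} (hN₀ : 0 ≤ N₀) (hW₀ : 0 ≤ W₀)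
    (hgs₀ : 0 ≤ gs₀) (hΛ : 0 ≤ Λ) (hS2 : 0 ≤ S2) (hS2Q : 0 ≤ S2Q) (hcPS : 0 ≤ cPS)
    (hM₁ : M₁ ≤ 3 * K₁ * N) (hM₂ : M₂ ≤ 9 * ((K₁ ^ 2 + K₁) * N)) :
    N₀ * (4 * W₀ * (g₀ ^ 2 + s₀ ^ 2 + gs₀) * M₁) +
      (4 * gs₀ * Λ * M₁ + 4 * W₀ * S2 * g₀ ^ 2 * M₁ + 4 * W₀ * g₀ ^ 2 * S2 * M₂) +
      (4 * W₀ * S2 * s₀ ^ 2 * M₁ + W₀ * s₀ ^ 2 * S2Q * M₂) + 2 * W₀ * g₀ ^ 4 * cPS * M₂ ≤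
      (N₀ * (4 * W₀ * (g₀ ^ 2 + s₀ ^ 2 + gs₀)) + 4 * gs₀ * Λ + 4 * W₀ * S2 * g₀ ^ 2 + 4 * W₀ * S2 * s₀ ^ 2) * (3 * K₁ * N) +
        (4 * W₀ * g₀ ^ 2 * S2 + W₀ * s₀ ^ 2 * S2Q + 2 * W₀ * g₀ ^ 4 * cPS) * (9 * ((K₁ ^ 2 + K₁) * N)) := by
  have hc1 : 0 ≤ N₀ * (4 * W₀ * (g₀ ^ 2 + s₀ ^ 2 + gs₀)) + 4 * gs₀ * Λ + 4 * W₀ * S2 * g₀ ^ 2 + 4 * W₀ * S2 * s₀ ^ 2 := by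
    positivity
  have hc2 : 0 ≤ 4 * W₀ * g₀ ^ 2 * S2 + W₀ * s₀ ^ 2 * S2Q + 2 * W₀ * g₀ ^ 4 * cPS := by positivity
  calc _ = (N₀ * (4 * W₀ * (g₀ ^ 2 + s₀ ^ 2 + gs₀)) + 4 * gs₀ * Λ + 4 * W₀ * S2 * g₀ ^ 2 + 4 * W₀ * S2 * s₀ ^ 2) * M₁ +
        (4 * W₀ * g₀ ^ 2 * S2 + W₀ * s₀ ^ 2 * S2Q + 2 * W₀ * g₀ ^ 4 * cPS) * M₂ := by ring
    _ ≤ _ := add_le_add (mul_le_mul_of_nonneg_left hM₁ hc1) (mul_le_mul_of_nonneg_left hM₂ hc2)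

set_option maxHeartbeats 1000000 in
/-- **The trial functional of the cubic vector, reduced to scalars** (Props. 3.1–3.2 of [ibid.] with
symbolic main terms). For `ξ_ν = cubicVector e P_H P_S κ` and Bogoliubov–Weyl data as in
`norm_quarticForm_sub_main_le`, an even weight `ε ≥ 0` vanishing at the condensate and `L > 0`:
`∑_p ε_p‖A_pξ_ν‖² + Re(∑ c⟨A_qA_pξ_ν, A_{q'}A_{p'}ξ_ν⟩)/(2L³) ≤ ‖ξ_ν‖²·{[∑ε σ² + ∑_τ w̃_τ|κ_τ|²]`
`+ (2L³)⁻¹[Re C + Re ∑_{b=b'}κ_{τ'}conj(κ_τ)K̃ + √N₀ Re ∑_τ c̃_τ conj κ_τ] + (2L³)⁻¹·errors}`,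
the errors being explicit polynomials in `K₁ = ∑|κ|²` and the sup parameters
(`W₀, g₀, s₀, gs₀, Λ, ∑σ², ∑_{P_H∪P_S}σ², |P_S|, F_m, A₀, F₁, F₂`): the kinetic constant and
`⟨𝒦⟩ + E₁`, the constants `ℒ^{(0)} + 𝒢^{(2,V)} + C_{G₂} + C_{G₃}` of `C_{𝒢_N}`, the main terms of
`⟨𝒱_N^{(H)}⟩` and `⟨𝒞_N⟩`, and the error terms of §4–§5 with `‖𝒩^{1/2}ξ_ν‖² ≤ 3K₁‖ξ_ν‖²`,
`‖𝒩ξ_ν‖²-type ≤ 9(K₁²+K₁)‖ξ_ν‖²` inserted.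
[cite: BastiCenatiempoSchlein2021, Prop. 3.1, Prop. 3.2, §4, §5] -/
theorem trialNumerator_cubicVector_le
    (hσ : Function.Involutive σ) (hP : ∀ p ∈ P, σ p ∉ P) (hσz : σ z = z)
    (he : Function.Injective e) (hez : e z = 0) (heσ : ∀ p, e (σ p) = -e p) (hN₀ : 0 ≤ N₀)
    (W : Momentum → ℂ) {W₀ : ℝ} (hW : ∀ k, ‖W k‖ ≤ W₀) (hWev : ∀ k, W (-k) = W k)
    (hHS : Disjoint PH PS) (hzH : z ∉ PH) (hzS : z ∉ PS) (hQσ : ∀ p ∈ PH ∪ PS, σ p ∈ PH ∪ PS)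
    {g₀ s₀ gs₀ Λ : ℝ} (hg₀ : 0 ≤ g₀) (hs₀ : 0 ≤ s₀) (hgs₀ : 0 ≤ gs₀)
    (hgQ : ∀ p ∈ PH ∪ PS, |bogGamma σ P t p| ≤ g₀) (hsQ : ∀ p ∈ PH ∪ PS, |bogSigma σ P t p| ≤ s₀)
    (hgsQ : ∀ p ∈ PH ∪ PS, |bogGamma σ P t p * bogSigma σ P t p| ≤ gs₀)
    (hΛle : ∀ k, ∑ p, ‖W (k - e p)‖ * |bogGamma σ P t p * bogSigma σ P t p| ≤ Λ)
    (κ : Triple e PH PS → ℂ) (ε : ι → ℝ) (hε : ∀ p, 0 ≤ ε p) (hεσ : ∀ p, ε (σ p) = ε p) (hεz : ε z = 0)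
    {L : ℝ} (hL : 0 < L) {Fm A₀ F₁ F₂ : ℝ} (hFm : 0 ≤ Fm) (hA₀ : 0 ≤ A₀) (hF₁ : 0 ≤ F₁) (hF₂ : 0 ≤ F₂)
    (hFmle : ∀ τ : Triple e PH PS, ‖arrSum (cubicCoeff e W (bogGamma σ P t) (bogSigma σ P t)) τ‖ ≤ Fm)
    (hA₀le : ∀ τ : Triple e PH PS, ∑ τ' : Triple e PH PS, (if τ'.b = τ.b then ‖κ τ'‖ else 0) ≤ A₀)
    (hF₁le : ∀ τ' : Triple e PH PS, ∑ τ : Triple e PH PS,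
      (if τ.b = τ'.b ∨ (∃ p, (p = τ.u ∨ p = τ.a) ∧ (p = τ'.u ∨ p = τ'.a)) ∨
          (∃ p, (p = τ.u ∨ p = τ.a) ∧ e p + e p + e τ'.b = 0) ∨ (∃ p', (p' = τ'.u ∨ p' = τ'.a) ∧ e p' + e p' + e τ.b = 0)
        then ‖κ τ‖ else 0) ≤ F₁)
    (hF₂le : ∀ τj τk : Triple e PH PS, τj ≠ τk → ∑ τ : Triple e PH PS,
      (if (∃ pj pk, (pj = τj.u ∨ pj = τj.a) ∧ (pk = τk.u ∨ pk = τk.a) ∧ e pj + e pk + e τ.b = 0) ∨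
          (∃ p pk, (p = τ.u ∨ p = τ.a) ∧ (pk = τk.u ∨ pk = τk.a) ∧ e p + e pk + e τj.b = 0)
        then ‖κ τ‖ else 0) ≤ F₂) :
    (∑ p, ε p * (fockInner (conjAn z σ P N₀ t p (cubicVector e PH PS κ)) (conjAn z σ P N₀ t p (cubicVector e PH PS κ))).re) +
      (∑ p, ∑ q, ∑ p', ∑ q', pairCoeff' e W p q p' q' *
        fockInner (conjAn z σ P N₀ t q (conjAn z σ P N₀ t p (cubicVector e PH PS κ)))
          (conjAn z σ P N₀ t q' (conjAn z σ P N₀ t p' (cubicVector e PH PS κ)))).re / (2 * L ^ 3) ≤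
      -- kinetic: constant + `⟨𝒦⟩ + E₁`
      ((∑ p, ε p * bogSigma σ P t p ^ 2) +
        ∑ τ : Triple e PH PS, (ε τ.u * (bogGamma σ P t τ.u ^ 2 + bogSigma σ P t τ.u ^ 2) +
          ε τ.a * (bogGamma σ P t τ.a ^ 2 + bogSigma σ P t τ.a ^ 2) +
          ε τ.b * (bogGamma σ P t τ.b ^ 2 + bogSigma σ P t τ.b ^ 2)) * ‖κ τ‖ ^ 2) * cubicNormSq κ +
      ( -- main terms of the quartic form: hard block, cubic block, constants
        (∑ τ' : Triple e PH PS, ∑ τ : Triple e PH PS, (if τ.b = τ'.b then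
          κ τ' * conj (κ τ) * (hardKernel e W (bogGamma σ P t) PH τ.u τ.a τ'.u τ'.a +
            hardKernel e W (bogGamma σ P t) PH τ.u τ.a τ'.a τ'.u + hardKernel e W (bogGamma σ P t) PH τ.a τ.u τ'.u τ'.a +
            hardKernel e W (bogGamma σ P t) PH τ.a τ.u τ'.a τ'.u) else 0)).re * cubicNormSq κ +
        Real.sqrt N₀ * ((∑ τ : Triple e PH PS, arrSum (cubicCoeff e W (bogGamma σ P t) (bogSigma σ P t)) τ * conj (κ τ)).re *
          cubicNormSq κ) +
        ((N₀ : ℂ) ^ 2 * W 0 +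
          (N₀ : ℂ) * (∑ p, ((2 * W 0 + W (e p) + W (-e p)) * ((bogSigma σ P t p ^ 2 : ℝ) : ℂ) +
            (W (e p) + W (-e p)) * ((bogGamma σ P t p * bogSigma σ P t p : ℝ) : ℂ))) +
          (∑ p, ∑ p', W (e p' - e p) *
            (((bogGamma σ P t p * bogSigma σ P t p * (bogGamma σ P t p' * bogSigma σ P t p')) : ℝ) : ℂ)) +
          ((∑ p, ∑ q, W (e q - e p) * (((bogSigma σ P t p ^ 2 * bogSigma σ P t q ^ 2 : ℝ)) : ℂ)) +
            W 0 * ((((∑ p, bogSigma σ P t p ^ 2) ^ 2 : ℝ)) : ℂ))).re * cubicNormSq κ +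
        -- errors
        ((8 * (W₀ * g₀ ^ 4) * A₀ * (F₁ * ampNormSq κ + F₂ * ampNormSq κ ^ 2) +
            16 * (W₀ * g₀ ^ 4) * (ampNormSq κ ^ 2 + ampNormSq κ)) * cubicNormSq κ +
          Real.sqrt N₀ * (Fm * (F₁ * ampNormSq κ + F₂ * ampNormSq κ ^ 2) * cubicNormSq κ) +
          ((N₀ * (4 * W₀ * (g₀ ^ 2 + s₀ ^ 2 + gs₀)) + 4 * gs₀ * Λ + 4 * W₀ * (∑ p, bogSigma σ P t p ^ 2) * g₀ ^ 2 +
              4 * W₀ * (∑ p, bogSigma σ P t p ^ 2) * s₀ ^ 2) * (3 * ampNormSq κ * cubicNormSq κ) +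
            (4 * W₀ * g₀ ^ 2 * (∑ p, bogSigma σ P t p ^ 2) + W₀ * s₀ ^ 2 * (∑ p ∈ PH ∪ PS, bogSigma σ P t p ^ 2) +
              2 * W₀ * g₀ ^ 4 * PS.card) * (9 * ((ampNormSq κ ^ 2 + ampNormSq κ) * cubicNormSq κ))))) / (2 * L ^ 3) := by
  set ξ := cubicVector e PH PS κ with hξdef
  have hNre : (fockInner ξ ξ).re = cubicNormSq κ := cubicNormSq_eq hHS κ
  have hNξ : fockInner ξ ξ = ((cubicNormSq κ : ℝ) : ℂ) := by rw [fockInner_self_eq_re, hNre]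
  have hN0 : 0 ≤ cubicNormSq κ := cubicNormSq_nonneg κ
  have hK0 : 0 ≤ ampNormSq κ := ampNormSq_nonneg κ
  have hW₀ : 0 ≤ W₀ := le_trans (norm_nonneg _) (hW 0)
  -- (1) kinetic
  have hK := kinetic_cubicVector_le (N₀ := N₀) (t := t) hσ hP hHS κ ε hε hεσ hεz
  rw [hNre] at hK
  -- (2) the quartic form: main terms and errors
  have h1 : (1 : ZMod 3) ≠ 0 := by decide
  have h2 : 2 • (1 : ZMod 3) ≠ 0 := by decide
  have h4 : 4 • (1 : ZMod 3) ≠ 0 := by decide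
  have hQ := norm_quarticForm_sub_main_le h1 h2 h4 hσ hP hσz he hez heσ hN₀ W hW hWev hHS hzH hzS hQσ hg₀ hs₀ hgs₀
    hgQ hsQ hgsQ hΛle (isWeightedHomogeneous_cubicVector_zmod3 κ) (isWeightedHomogeneous_cubicVector_hs hHS κ)
    (fun p hp => pderiv_cubicVector_eq_zero_of_not_mem_union κ hp)
  rw [← hξdef] at hQ
  -- moments
  have hM₁ : ∑ p, (fockInner (pderiv p ξ) (pderiv p ξ)).re ≤ 3 * ampNormSq κ * cubicNormSq κ := by
    have h := sum_mul_fockInner_pderiv_cubicVector_le hHS κ (fun _ => (1 : ℝ)) (fun _ => zero_le_one)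
    simp only [one_mul, hξdef] at h ⊢
    rw [hNre] at h
    refine h.trans (le_of_eq ?_)
    have h3 : ∑ τ : Triple e PH PS, ((1 : ℝ) + 1 + 1) * ‖κ τ‖ ^ 2 = 3 * ampNormSq κ := by
      unfold ampNormSq; rw [Finset.mul_sum]; exact Finset.sum_congr rfl fun τ _ => by ring
    rw [h3]
  have hM₂ : ∑ x, ∑ y, (fockInner (pderiv y (pderiv x ξ)) (pderiv y (pderiv x ξ))).re ≤
      9 * ((ampNormSq κ ^ 2 + ampNormSq κ) * cubicNormSq κ) :=
    (sum_sum_fockInner_pderiv_pderiv_cubicVector_le hHS κ).trans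
      (mul_le_mul_of_nonneg_left (sum_normSq_setCoeff_mul_card_sq_le' κ) (by norm_num))
  -- the two symbolic blocks
  have hB := re_hardBlock_cubicVector_le (σ := σ) (P := P) (t := t) he hHS κ W hW hg₀ hA₀ hF₁ hF₂
    (fun p hp => hgQ p (Finset.mem_union_left _ hp)) hA₀le hF₁le hF₂le
  have hC := re_cubicBlock_cubicVector_le (σ := σ) (P := P) (t := t) he hHS κ W hFm hF₁ hF₂ hFmle hF₁le hF₂le
  rw [← hξdef] at hB hC
  -- real part of the main term
  have hsq : 0 ≤ Real.sqrt N₀ := Real.sqrt_nonneg _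
  have hre := re_le_re_add_norm_sub
    (∑ p, ∑ q, ∑ p', ∑ q', pairCoeff' e W p q p' q' *
      fockInner (conjAn z σ P N₀ t q (conjAn z σ P N₀ t p ξ)) (conjAn z σ P N₀ t q' (conjAn z σ P N₀ t p' ξ)))
    ((∑ p ∈ PH, ∑ q ∈ PH, ∑ p' ∈ PH, ∑ q' ∈ PH, pairCoeff' e W p q p' q' *
          ((bogGamma σ P t q * bogGamma σ P t p * (bogGamma σ P t q' * bogGamma σ P t p') : ℝ) : ℂ) *
            fockInner (pderiv q (pderiv p ξ)) (pderiv q' (pderiv p' ξ))) +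
        (Real.sqrt N₀ : ℂ) * (∑ i, ∑ j, ∑ k, (if e i + e j + e k = 0 then
          ((W (-e k) + W (e j)) * ((bogGamma σ P t i * bogSigma σ P t j * bogSigma σ P t k : ℝ) : ℂ) +
              (W (-e i) + W (e j)) * ((bogGamma σ P t i * bogGamma σ P t j * bogSigma σ P t k : ℝ) : ℂ)) *
            fockInner ξ (X i * (X j * (X k * ξ))) +
          ((W (e k) + W (-e j)) * ((bogGamma σ P t i * bogSigma σ P t j * bogSigma σ P t k : ℝ) : ℂ) +
              (W (e i) + W (-e j)) * ((bogGamma σ P t i * bogGamma σ P t j * bogSigma σ P t k : ℝ) : ℂ)) *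
            fockInner (X i * (X j * (X k * ξ))) ξ else 0)) +
        ((N₀ : ℂ) ^ 2 * W 0 +
          (N₀ : ℂ) * (∑ p, ((2 * W 0 + W (e p) + W (-e p)) * ((bogSigma σ P t p ^ 2 : ℝ) : ℂ) +
            (W (e p) + W (-e p)) * ((bogGamma σ P t p * bogSigma σ P t p : ℝ) : ℂ))) +
          (∑ p, ∑ p', W (e p' - e p) *
            (((bogGamma σ P t p * bogSigma σ P t p * (bogGamma σ P t p' * bogSigma σ P t p')) : ℝ) : ℂ)) +
          ((∑ p, ∑ q, W (e q - e p) * (((bogSigma σ P t p ^ 2 * bogSigma σ P t q ^ 2 : ℝ)) : ℂ)) +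
            W 0 * ((((∑ p, bogSigma σ P t p ^ 2) ^ 2 : ℝ)) : ℂ))) * fockInner ξ ξ)
  rw [hNξ] at hre hQ
  have hmain_re : ((∑ p ∈ PH, ∑ q ∈ PH, ∑ p' ∈ PH, ∑ q' ∈ PH, pairCoeff' e W p q p' q' *
          ((bogGamma σ P t q * bogGamma σ P t p * (bogGamma σ P t q' * bogGamma σ P t p') : ℝ) : ℂ) *
            fockInner (pderiv q (pderiv p ξ)) (pderiv q' (pderiv p' ξ))) +
        (Real.sqrt N₀ : ℂ) * (∑ i, ∑ j, ∑ k, (if e i + e j + e k = 0 then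
          ((W (-e k) + W (e j)) * ((bogGamma σ P t i * bogSigma σ P t j * bogSigma σ P t k : ℝ) : ℂ) +
              (W (-e i) + W (e j)) * ((bogGamma σ P t i * bogGamma σ P t j * bogSigma σ P t k : ℝ) : ℂ)) *
            fockInner ξ (X i * (X j * (X k * ξ))) +
          ((W (e k) + W (-e j)) * ((bogGamma σ P t i * bogSigma σ P t j * bogSigma σ P t k : ℝ) : ℂ) +
              (W (e i) + W (-e j)) * ((bogGamma σ P t i * bogGamma σ P t j * bogSigma σ P t k : ℝ) : ℂ)) *
            fockInner (X i * (X j * (X k * ξ))) ξ else 0)) +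
        ((N₀ : ℂ) ^ 2 * W 0 +
          (N₀ : ℂ) * (∑ p, ((2 * W 0 + W (e p) + W (-e p)) * ((bogSigma σ P t p ^ 2 : ℝ) : ℂ) +
            (W (e p) + W (-e p)) * ((bogGamma σ P t p * bogSigma σ P t p : ℝ) : ℂ))) +
          (∑ p, ∑ p', W (e p' - e p) *
            (((bogGamma σ P t p * bogSigma σ P t p * (bogGamma σ P t p' * bogSigma σ P t p')) : ℝ) : ℂ)) +
          ((∑ p, ∑ q, W (e q - e p) * (((bogSigma σ P t p ^ 2 * bogSigma σ P t q ^ 2 : ℝ)) : ℂ)) +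
            W 0 * ((((∑ p, bogSigma σ P t p ^ 2) ^ 2 : ℝ)) : ℂ))) * ((cubicNormSq κ : ℝ) : ℂ)).re =
      ((∑ p ∈ PH, ∑ q ∈ PH, ∑ p' ∈ PH, ∑ q' ∈ PH, pairCoeff' e W p q p' q' *
          ((bogGamma σ P t q * bogGamma σ P t p * (bogGamma σ P t q' * bogGamma σ P t p') : ℝ) : ℂ) *
            fockInner (pderiv q (pderiv p ξ)) (pderiv q' (pderiv p' ξ)))).re +
        Real.sqrt N₀ * ((∑ i, ∑ j, ∑ k, (if e i + e j + e k = 0 then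
          ((W (-e k) + W (e j)) * ((bogGamma σ P t i * bogSigma σ P t j * bogSigma σ P t k : ℝ) : ℂ) +
              (W (-e i) + W (e j)) * ((bogGamma σ P t i * bogGamma σ P t j * bogSigma σ P t k : ℝ) : ℂ)) *
            fockInner ξ (X i * (X j * (X k * ξ))) +
          ((W (e k) + W (-e j)) * ((bogGamma σ P t i * bogSigma σ P t j * bogSigma σ P t k : ℝ) : ℂ) +
              (W (e i) + W (-e j)) * ((bogGamma σ P t i * bogGamma σ P t j * bogSigma σ P t k : ℝ) : ℂ)) *
            fockInner (X i * (X j * (X k * ξ))) ξ else 0))).re +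
        (((N₀ : ℂ) ^ 2 * W 0 +
          (N₀ : ℂ) * (∑ p, ((2 * W 0 + W (e p) + W (-e p)) * ((bogSigma σ P t p ^ 2 : ℝ) : ℂ) +
            (W (e p) + W (-e p)) * ((bogGamma σ P t p * bogSigma σ P t p : ℝ) : ℂ))) +
          (∑ p, ∑ p', W (e p' - e p) *
            (((bogGamma σ P t p * bogSigma σ P t p * (bogGamma σ P t p' * bogSigma σ P t p')) : ℝ) : ℂ)) +
          ((∑ p, ∑ q, W (e q - e p) * (((bogSigma σ P t p ^ 2 * bogSigma σ P t q ^ 2 : ℝ)) : ℂ)) +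
            W 0 * ((((∑ p, bogSigma σ P t p ^ 2) ^ 2 : ℝ)) : ℂ)))).re * cubicNormSq κ := by
    simp only [Complex.add_re, Complex.re_ofReal_mul, Complex.re_mul_ofReal, add_mul]
  rw [hmain_re] at hre
  -- error of the quartic form in terms of `K₁`
  have hM₁0 : 0 ≤ ∑ p, (fockInner (pderiv p ξ) (pderiv p ξ)).re := Finset.sum_nonneg fun p _ => fockInner_self_re_nonneg _
  have hM₂0 : 0 ≤ ∑ x, ∑ y, (fockInner (pderiv y (pderiv x ξ)) (pderiv y (pderiv x ξ))).re :=
    Finset.sum_nonneg fun x _ => Finset.sum_nonneg fun y _ => fockInner_self_re_nonneg _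
  have hS20 : 0 ≤ ∑ p, bogSigma σ P t p ^ 2 := Finset.sum_nonneg fun p _ => sq_nonneg _
  have hS2Q0 : 0 ≤ ∑ p ∈ PH ∪ PS, bogSigma σ P t p ^ 2 := Finset.sum_nonneg fun p _ => sq_nonneg _
  have hΛ0 : 0 ≤ Λ := le_trans (Finset.sum_nonneg fun p _ => mul_nonneg (norm_nonneg _) (abs_nonneg _)) (hΛle 0)
  have hERR : N₀ * (4 * W₀ * (g₀ ^ 2 + s₀ ^ 2 + gs₀) * ∑ p, (fockInner (pderiv p ξ) (pderiv p ξ)).re) +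
      (4 * gs₀ * Λ * ∑ p, (fockInner (pderiv p ξ) (pderiv p ξ)).re +
        4 * W₀ * (∑ p, bogSigma σ P t p ^ 2) * g₀ ^ 2 * ∑ p, (fockInner (pderiv p ξ) (pderiv p ξ)).re +
        4 * W₀ * g₀ ^ 2 * (∑ p, bogSigma σ P t p ^ 2) *
          ∑ x, ∑ y, (fockInner (pderiv y (pderiv x ξ)) (pderiv y (pderiv x ξ))).re) +
      (4 * W₀ * (∑ p, bogSigma σ P t p ^ 2) * s₀ ^ 2 * ∑ p, (fockInner (pderiv p ξ) (pderiv p ξ)).re +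
        W₀ * s₀ ^ 2 * (∑ p ∈ PH ∪ PS, bogSigma σ P t p ^ 2) *
          ∑ x, ∑ y, (fockInner (pderiv y (pderiv x ξ)) (pderiv y (pderiv x ξ))).re) +
      2 * W₀ * g₀ ^ 4 * PS.card * ∑ x, ∑ y, (fockInner (pderiv y (pderiv x ξ)) (pderiv y (pderiv x ξ))).re ≤
      (N₀ * (4 * W₀ * (g₀ ^ 2 + s₀ ^ 2 + gs₀)) + 4 * gs₀ * Λ + 4 * W₀ * (∑ p, bogSigma σ P t p ^ 2) * g₀ ^ 2 +
          4 * W₀ * (∑ p, bogSigma σ P t p ^ 2) * s₀ ^ 2) * (3 * ampNormSq κ * cubicNormSq κ) +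
        (4 * W₀ * g₀ ^ 2 * (∑ p, bogSigma σ P t p ^ 2) + W₀ * s₀ ^ 2 * (∑ p ∈ PH ∪ PS, bogSigma σ P t p ^ 2) +
          2 * W₀ * g₀ ^ 4 * PS.card) * (9 * ((ampNormSq κ ^ 2 + ampNormSq κ) * cubicNormSq κ)) :=
    errQ_le_of_moments hN₀ hW₀ hgs₀ hΛ0 hS20 hS2Q0 (Nat.cast_nonneg _) (by linarith [hM₁]) hM₂
  -- combine
  have h2L : 0 < 2 * L ^ 3 := by positivity
  have hQre : (∑ p, ∑ q, ∑ p', ∑ q', pairCoeff' e W p q p' q' *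
      fockInner (conjAn z σ P N₀ t q (conjAn z σ P N₀ t p ξ)) (conjAn z σ P N₀ t q' (conjAn z σ P N₀ t p' ξ))).re ≤
      (∑ τ' : Triple e PH PS, ∑ τ : Triple e PH PS, (if τ.b = τ'.b then
          κ τ' * conj (κ τ) * (hardKernel e W (bogGamma σ P t) PH τ.u τ.a τ'.u τ'.a +
            hardKernel e W (bogGamma σ P t) PH τ.u τ.a τ'.a τ'.u + hardKernel e W (bogGamma σ P t) PH τ.a τ.u τ'.u τ'.a +
            hardKernel e W (bogGamma σ P t) PH τ.a τ.u τ'.a τ'.u) else 0)).re * cubicNormSq κ +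
        Real.sqrt N₀ * ((∑ τ : Triple e PH PS, arrSum (cubicCoeff e W (bogGamma σ P t) (bogSigma σ P t)) τ * conj (κ τ)).re *
          cubicNormSq κ) +
        ((N₀ : ℂ) ^ 2 * W 0 +
          (N₀ : ℂ) * (∑ p, ((2 * W 0 + W (e p) + W (-e p)) * ((bogSigma σ P t p ^ 2 : ℝ) : ℂ) +
            (W (e p) + W (-e p)) * ((bogGamma σ P t p * bogSigma σ P t p : ℝ) : ℂ))) +
          (∑ p, ∑ p', W (e p' - e p) *
            (((bogGamma σ P t p * bogSigma σ P t p * (bogGamma σ P t p' * bogSigma σ P t p')) : ℝ) : ℂ)) +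
          ((∑ p, ∑ q, W (e q - e p) * (((bogSigma σ P t p ^ 2 * bogSigma σ P t q ^ 2 : ℝ)) : ℂ)) +
            W 0 * ((((∑ p, bogSigma σ P t p ^ 2) ^ 2 : ℝ)) : ℂ))).re * cubicNormSq κ +
        ((8 * (W₀ * g₀ ^ 4) * A₀ * (F₁ * ampNormSq κ + F₂ * ampNormSq κ ^ 2) +
            16 * (W₀ * g₀ ^ 4) * (ampNormSq κ ^ 2 + ampNormSq κ)) * cubicNormSq κ +
          Real.sqrt N₀ * (Fm * (F₁ * ampNormSq κ + F₂ * ampNormSq κ ^ 2) * cubicNormSq κ) +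
          ((N₀ * (4 * W₀ * (g₀ ^ 2 + s₀ ^ 2 + gs₀)) + 4 * gs₀ * Λ + 4 * W₀ * (∑ p, bogSigma σ P t p ^ 2) * g₀ ^ 2 +
              4 * W₀ * (∑ p, bogSigma σ P t p ^ 2) * s₀ ^ 2) * (3 * ampNormSq κ * cubicNormSq κ) +
            (4 * W₀ * g₀ ^ 2 * (∑ p, bogSigma σ P t p ^ 2) + W₀ * s₀ ^ 2 * (∑ p ∈ PH ∪ PS, bogSigma σ P t p ^ 2) +
              2 * W₀ * g₀ ^ 4 * PS.card) * (9 * ((ampNormSq κ ^ 2 + ampNormSq κ) * cubicNormSq κ)))) := by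
    have hC' := mul_le_mul_of_nonneg_left hC hsq
    linarith [hre, hQ, hERR, hB, hC']
  have hdiv := div_le_div_of_nonneg_right hQre h2L.le
  linarith [hK, hdiv]

end Final


end Fock

end Literature.MathematicalPhysics.QuantumManyBody.BoseGas

end
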